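import Summits.Ventures.PercRepro.ProfileGapMonoThresholdThreeLinesFlatUp
import Summits.Ventures.PercRepro.ProfileGapMonoThresholdThreeLinesDisjoint

/-!
# PercRepro — THE CO-RANK-3 THRESHOLD FAMILY ON SIMPLE MATROIDS WHOSE LINES HAVE AT MOST 3 POINTS:
`(I_t)` at `q = 3` for every `t ≥ 2` (p5, gen 29; `proofs/P5-GM1.md` §34; announced INBOX 13565)

Through the excess form (`thresholdIneq_iff_excess`): the demanding bad sets (`…ThreeLinesBad`) are injected into the
slack `Σ_{S∈T_t} (3 − d_t(S))` by the flat-up rule when `t + 4 ≤ #E` (`…ThreeLinesFlatUp`), by the disjoint rule when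
`t + 3 = #E` (`…ThreeLinesDisjoint`), and do not exist when `#E ≤ t + 2`.
**`thresholdIneq_three_of_lines_le_three`**: on a simple matroid (every two distinct points of rank `2`) whose rank-`2`
flats have at most `3` elements — every binary matroid's simplification — `ThresholdIneq N 3 t` for every `t ≥ 2`, the
open range `t ≥ 4` included; **`starQ_three_four_of_lines_le_three`**: `(★_3)` at `u = 4` on such a deletion `M ∖ z`.
Nothing beyond the stated regime is asserted.
-/

open scoped Matroid

namespace PercRepro.Cogirth

open Finset ThmH Skew Shadow Profile

variable {α : Type} [DecidableEq α] {N : Matroid α} [N.Finite]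

section Main

/-- **THE CO-RANK-3 THRESHOLD FAMILY ON SIMPLE MATROIDS WHOSE LINES HAVE AT MOST 3 POINTS**: if every two distinct
points have rank `2` and every rank-`2` flat has at most `3` elements (every binary matroid's simplification), then
`ThresholdIneq N 3 t` holds for every `t ≥ 2` — the open range `t ≥ 4` included. -/
theorem thresholdIneq_three_of_lines_le_three (hpair : ∀ x ∈ gr N, ∀ y ∈ gr N, x ≠ y → rk N {x, y} = 2)
    (hline : ∀ B ∈ Rq N 2, (clF N B).card ≤ 3) {t : ℕ} (ht : 2 ≤ t) : ThresholdIneq N 3 t := by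
  rw [thresholdIneq_iff_excess (by norm_num)]
  simp only [Nat.reduceSub]
  have h1 := thresholdSum_three_le_add_card_bad N t hline
  have h2 : (((Rq N 2).filter (fun B => t + 1 ≤ rk N (gr N \ B))).filter
      (fun B => B.card = 2 ∧ (clF N B).card = 3 ∧ rk N (gr N \ B) = (gr N \ B).card)).card ≤
      ∑ S ∈ levelSetCoQ N t 3,
        (3 - ((coloops N S).filter
          (fun y => S.erase y ∈ (Rq N 2).filter (fun B => t + 1 ≤ rk N (gr N \ B)))).card) := by
    rcases lt_trichotomy (t + 3) (gr N).card with hlt | heq | hgt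
    · exact card_bad_le_of_add_four_le hpair (by omega) (by omega)
    · exact card_bad_le_of_add_three_eq hpair ht heq
    · rw [filter_bad_eq_empty_of_card_le (by omega), card_empty]
      exact Nat.zero_le _
  omega

/-- **`(★_3)` at the level `u = 4`** on a deletion `M ∖ z` that is simple with lines of at most `3` points
(the first open instance of the coloop band case, §21(a)): `StarQ M z 3 4`. -/
theorem starQ_three_four_of_lines_le_three {M : Matroid α} [M.Finite] {z : α}
    (hpair : ∀ x ∈ gr (M ＼ ({z} : Set α)), ∀ y ∈ gr (M ＼ ({z} : Set α)), x ≠ y →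
      rk (M ＼ ({z} : Set α)) {x, y} = 2)
    (hline : ∀ B ∈ Rq (M ＼ ({z} : Set α)) 2, (clF (M ＼ ({z} : Set α)) B).card ≤ 3) :
    StarQ M z 3 4 :=
  (starQ_succ_iff_thresholdIneq (by norm_num)).2
    (thresholdIneq_three_of_lines_le_three hpair hline (by norm_num))

end Main

end PercRepro.Cogirth
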